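import Summits.QuantumAdvantage.QuantumAdvantage.Theses.CompactnessLift
import Literature.Computability.Complexity.RelativizedTime
import Literature.Computability.QuantumComplexity.BQTime

/-!
# Lead-prover verdict certificate — crux `stmt-QuantumAdvantage-15271` (`LanguageLadder`, route CompactnessLift)

Seat `prover-line-stmt-QuantumAdvantage-15271-0` (MODE line, lead). The single "line" served
(`Ideator2Notes.lean`) is not a skeleton (`ledger skeleton check`: FAIL skeleton.missing — 0 `stub_*`,
0 `sorry`, no `LanguageLadder_proof`), so no line can be driven. This file is the kernel-checked part of
the verdict `misstated`, bound to the REAL route decl and using NO folklore hypothesis except where a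
hypothesis is an explicit argument:

* `ladderSwap_of_languageLadder` (UNCONDITIONAL, new): the crux AS TYPED already yields the
  quantifier-swapped statement — ONE language of `BQTIME(n²)` outside EVERY `BPTIME(n^k)` — because
  `BPTime (· ^ k) ⊆ bp (DTIME id) ⊆ bp (DTIME (· ^ 1))` for every `k` (`bpTime_pow_subset_bp`, in the
  tree): the coin polynomial of `bp` is free padding, so rung `c = 1` of the typed ladder is
  "`BQTIME(n²) ⊄ ⋃ k, BPTIME(n^k)`", i.e. Arora–Barak's `BQTIME(n²) ⊄ BPP` — summit strength.
* `languageLadder_iff_tail_one` (UNCONDITIONAL): the `∀ c` of the typed crux is decorative downward —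
  `LanguageLadder ↔ ∀ c ≥ 1, rung c`, rung `c` implies rung `c'` for `1 ≤ c' ≤ c`
  (`bp_DTIME_pow_mono`), and rung 0 carries nothing (`bp (DTIME n^0) ⊆ bp (DTIME n^1)`,
  `bp_DTIME_pow_zero_subset`); upward (`rung 1 ⇒ rung c`) is exactly the folklore padding collapse.
* `summit_of_languageLadder_of_bppCovered` (mod the folklore coin-splitting `BPP ⊆ ⋃ k, BPTIME(n^k)`,
  explicit hypothesis): typed crux ⇒ `QuantumAdvantage`. (The census reaches the same conclusion mod
  the other folklore padding `BPP ⊆ bp (DTIME n^{c₀})`; either one folklore TM construction makes the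
  typed crux literally ≥ the summit.)
* `languageLadderRepaired_of_languageLadder` (UNCONDITIONAL): typed ⇒ the refuter's repaired
  statement C′ over `BQTime/BPTime`, which is what the item should say.
-/

namespace Summit.QuantumAdvantage.QuantumAdvantage.Cruxes.LanguageLadder.LeadVerdict

set_option linter.dupNamespace false

open Literature.Computability.Complexity Literature.Computability.QuantumComplexity
open Summit.QuantumAdvantage.QuantumAdvantage.Theses.CompactnessLift

/-- `bp (DTIME n) ⊆ bp (DTIME n^1)` (the two bounds agree pointwise). -/
theorem bp_DTIME_id_subset_bp_DTIME_pow_one :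
    bp (DTIME fun n => n) ⊆ bp (DTIME fun n => n ^ 1) :=
  bp_mono (DTIME_mono fun n => by simp)

/-- **V1 (unconditional).** The crux as typed implies the quantifier swap: one quadratic-uniform
Clifford+T language outside every `BPTIME(n^k)` — textbook `BQTIME(n²) ⊄ BPP`. -/
theorem ladderSwap_of_languageLadder (h : LanguageLadder) :
    ∃ L ∈ BQTime (fun n => n ^ 2), ∀ k : ℕ, L ∉ BPTime (fun n => n ^ k) := by
  obtain ⟨L, hL, hno⟩ := h 1
  refine ⟨L, hL, fun k hk => hno ?_⟩
  exact bp_DTIME_id_subset_bp_DTIME_pow_one (bpTime_pow_subset_bp (DTIME fun n => n) k hk)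

/-- Rung nesting of the typed ladder, downward and unconditional: `bp (DTIME n^c') ⊆ bp (DTIME n^c)`
for `1 ≤ c' ≤ c`. -/
theorem bp_DTIME_pow_mono {c' c : ℕ} (hc' : 1 ≤ c') (h : c' ≤ c) :
    bp (DTIME fun n => n ^ c') ⊆ bp (DTIME fun n => n ^ c) := by
  refine bp_mono (DTIME_mono fun n => ?_)
  rcases Nat.eq_zero_or_pos n with rfl | hn
  · simp [Nat.pos_iff_ne_zero.mp (by omega : 0 < c'), Nat.pos_iff_ne_zero.mp (by omega : 0 < c)]
  · exact Nat.pow_le_pow_right hn h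

/-- Rung 0 is below rung 1 as well: `DTIME (n^0) = DTIME 1 ⊆ DTIME (n^1)` (constant `2c`). -/
theorem bp_DTIME_pow_zero_subset : bp (DTIME fun n => n ^ 0) ⊆ bp (DTIME fun n => n ^ 1) := by
  refine bp_mono ?_
  rintro L ⟨c, hc⟩
  refine ⟨2 * c, timeClass_mono (fun n => ?_) hc⟩
  simp only [pow_zero, mul_one, pow_one]
  nlinarith

/-- **V2 (unconditional).** The `∀ c` is decorative: the typed crux is equivalent to its tail from
`c = 1`, every rung of which is implied by any higher rung. -/
theorem languageLadder_iff_tail_one :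
    LanguageLadder ↔ ∀ c : ℕ, 1 ≤ c → ∃ L ∈ BQTime (fun n => n ^ 2), L ∉ bp (DTIME fun n => n ^ c) := by
  constructor
  · exact fun h c _ => h c
  · intro h c
    rcases Nat.eq_zero_or_pos c with rfl | hc
    · obtain ⟨L, hL, hno⟩ := h 1 le_rfl
      exact ⟨L, hL, fun h0 => hno (bp_DTIME_pow_zero_subset h0)⟩
    · exact h c hc

/-- **Coin splitting** `BPP ⊆ ⋃ k, BPTIME(n^k)` (folklore TM construction, NOT in the tree —
`RelativizedTime.lean`, "Not here"). Explicit hypothesis, never assumed globally. -/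
def BPPCovered : Prop :=
  BPP ⊆ ⋃ k : ℕ, BPTime (fun n => n ^ k)

/-- **V3 (mod coin splitting only).** The crux as typed implies the summit: probe `C → S` succeeds,
so any skeleton concluding `LanguageLadder` carries a summit-strength stub. -/
theorem summit_of_languageLadder_of_bppCovered (hcov : BPPCovered) (h : LanguageLadder) :
    _root_.QuantumAdvantage := by
  obtain ⟨L, hLq, hL⟩ := ladderSwap_of_languageLadder h
  refine ⟨L, BQTime_pow_subset_BQP 2 hLq, fun hB => ?_⟩
  obtain ⟨k, hk⟩ := Set.mem_iUnion.1 (hcov hB)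
  exact hL k hk

/-- **C′ — what the item should say** (refuter rattack-15271 / census `LanguageLadderR`, verbatim):
an honest `BPTIME(n^c)` with `O(n^c)` coins and running time measured in `|x|`. -/
def LanguageLadderRepaired : Prop :=
  ∀ c : ℕ, ∃ L ∈ BQTime (fun n => n ^ 2), L ∉ BPTime (fun n => n ^ c)

/-- **V4 (unconditional).** Typed ⇒ repaired: the filed statement is the STRONGER one. -/
theorem languageLadderRepaired_of_languageLadder (h : LanguageLadder) : LanguageLadderRepaired := by
  obtain ⟨L, hL, hno⟩ := ladderSwap_of_languageLadder h
  exact fun c => ⟨L, hL, hno c⟩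

end Summit.QuantumAdvantage.QuantumAdvantage.Cruxes.LanguageLadder.LeadVerdict
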